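/-
Copyright (c) 2026 the pub-hodgecm-mathlib formalisation cell (harness21).  Prover seat hodgecm-mathlib-R90-C14-p01 (g0), R90-TF section S8 «ContSpec-n½» (dealer R90-CS-plan (g0),
hand T2-(i), 2026-09-04), h413 = `stmt-HodgeConjecture-24833`: the LEVEL-`K′` twin of ★ p12 `K2E1ContinuedEisensteinResidueConstantTermUTwo` — the CONSTANT TERM of the residue function of
the continued Eisenstein series on `U(J₂)` attached to an ARBITRARY section is the constant `r = lim (z−1)ψ(z, g)`, along EVERY Haar measure and EVERY fundamental domain.
-/
import Summits.HodgeConjecture.HodgeConjecture.Theorems.K2E1ContinuedEisensteinResidueConstantTermUTwo   -- ★ the `φ₀`-typed original (§2) and the rank-generic transports §1 `borelConstantTerm_smul_measure_eq`, `borelConstantTerm_eq_of_isFundamentalDomain`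
import HarnessLib

/-!
# K2·E1 ∕ R90-TF S8 — `K2E1ContinuedEisensteinResidueConstantTermLevelUTwo` (hand T2-(i) of `Theorems/K2E1EisensteinResidueLevelConstantU2.lean`, `U(J₂)_{E/F}`): THE CONSTANT TERM OF
# THE RESIDUE FUNCTION `g ↦ Res_{z=1}Ẽ(z)(g)` OF A LEVEL-`K′` SECTION IS THE CONSTANT `r`, ALONG EVERY HAAR MEASURE OF `N(𝔸)` AND EVERY FUNDAMENTAL DOMAIN OF `N(F)` — the letter (L-CT)

Track B ∕ K2-LIT inside programme R90-TF (brief `director/R90-BRIEF.v2.md` 1f40d54518340a35), section S8 = continuous spectrum ∕ `n = ½` (base `R90-CS`), crux h413 =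
`stmt-HodgeConjecture-24833`, route of record `HCCMUnconditional`; cell `hodgecm-mathlib`.  Prover seat `hodgecm-mathlib-R90-C14-p01` (g0) (re-dealt S6 → S8 by R90-TF LEAD #17), hand
T2-(i) of the dealer R90-CS-plan (g0) (R90 bus 2026-09-04T16:05:50Z), census of K2E1-p10 (g3) (16:05:37Z: «every link of the ★ R5 chain is typed at `fun _ => φ₀`»).  THEOREMS ONLY (no
`def`, no `instance`, no notation, no named-fact hypothesis, no `sorry`); lane `--supports stmt-HodgeConjecture-24833 --as helper` (count-neutral).  Closes no socket.

THE MATHEMATICS ([MoeglinWaldspurger1995, IV.1.11, II.1.7]; [Langlands1976, §7]).  ★ `K2E1ContinuedEisensteinResidueConstantTermUTwo.integrableOn_and_setIntegral_residueValue_sub_eq_zero`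
computes the constant term of the residue function from the SCALAR constant-term letter `Ẽ(z)_B(g) = φ₀·(H(g)^z + c̃(z)H(g)^{1−z})` of the `K_max`-spherical section `φ₀`.  For a section
`φ₁` of arbitrary level `K′` the constant term of the continued Eisenstein series along `B` is `Ẽ(z)_B(g) = φ₁(g)·H(g)^z + ψ(z, g)·H(g)^{1−z}` with `ψ(z, ·) = (M(z)φ₁)` the intertwined
section ([MoeglinWaldspurger1995, II.1.7]); this file takes that LEVEL-`K′` letter `hE3` together with the pole letter `hψ : (z−1)·ψ(z, g) → r` (ONE constant `r` for all `g` — the place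
where «the residual intertwining operator at the top pole has constant image» enters, openly, as a hypothesis) and runs the ★ argument verbatim: with `Φ_g(z) = (z−1)Ẽ(z)(g)` bounded
near `1` uniformly for `g` in compacts (★ `K2E1ContinuedEisensteinResidueFunctionUTwo`), dominated convergence on the compact line-unipotent fundamental domain `𝓕₀ = n(𝓕⁻)` (★
`UnitaryGroupLineUnipotentTwo`) gives `∫_{𝓕₀} Res Ẽ(u g) dν'(u) = lim_{z→1} (z−1)·ν'(𝓕₀)·Ẽ(z)_B(g) = ν'(𝓕₀)·lim (z−1)(φ₁(g)H(g)^z + ψ(z,g)H(g)^{1−z}) = ν'(𝓕₀)·(0 + r·H(g)^0) = ν'(𝓕₀)·r`,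
the reference identity being transported from `(ν, 𝓕)` to `(ν', 𝓕₀)` by ★ §1 (Haar uniqueness; independence of the fundamental domain for left-`G(F)`-invariant functions) and then
from `𝓕₀` to the arbitrary `𝓕'` (Mathlib `IsFundamentalDomain.setIntegral_eq ∕ integrableOn_iff`).
* **`integrableOn_and_setIntegral_residueValue_sub_eq_zero_level`** — for EVERY Haar `ν'` on `N(𝔸)` and EVERY fundamental domain `𝓕'` of `N(F)`: `u ↦ F(u·x) 1 − r` is integrable on
  `𝓕'` with integral `0` — the letter (L-CT) «the constant term of `g ↦ F g 1` is the constant `r`» in the shape of ★ (1) with `φ₀·r ↦ r` (consumer: the T1 assembly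
  `K2E1EisensteinResidueLevelConstantU2` of K2E1-p10 (g3)).
HONEST LABEL: HC_CM is proved only modulo the 7 printed citations (2 remaining named inputs: hLiu418 = `stmt-HodgeConjecture-24832`, h413 = `stmt-HodgeConjecture-24833`) until rung 0
closes; this file asserts no named fact and closes no socket; its head is CONDITIONAL on the EXPORTS₂ letters (E1)(E4)(E2-bd), the level-`K′` constant-term letter (E3′-K′) and the pole
letters (F), `(z−1)ψ(z, g) → r`.
References: [MoeglinWaldspurger1995] I.2.6, II.1.7, IV.1.11 · [Langlands1976] §7 · [Rogawski1990] §2.1 · [BorelJacquet1979] §4.4.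
-/

set_option autoImplicit false
-- the mandated namespace repeats the single-problem summit's segment (`HodgeConjecture.HodgeConjecture`)
set_option linter.dupNamespace false

noncomputable section

open MeasureTheory Measure NumberField IsDedekindDomain Set Filter Topology Metric MulAction
open scoped ENNReal NNReal Pointwise
open Literature.NumberTheory
open Literature.NumberTheory.Automorphic Literature.NumberTheory.Automorphic.UnitaryGroup AdelicGroupData
open Summit.HodgeConjecture.HodgeConjecture.Cruxes.H413.K2E1ContinuedEisensteinResidueFunctionUTwo
open Summit.HodgeConjecture.HodgeConjecture.Cruxes.H413.K2E1ContinuedEisensteinResidueConstantTermUTwo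

namespace Summit.HodgeConjecture.HodgeConjecture.Cruxes.H413.K2E1ContinuedEisensteinResidueConstantTermLevelUTwo

variable {F E : Type} [Field F] [NumberField F] [Field E] [NumberField E] [Algebra F E] {c : E ≃ₐ[F] E}

section ConstantTerm

variable [MeasurableSpace (quasiSplit F E c 2).Adelic] [BorelSpace (quasiSplit F E c 2).Adelic]

/-- **THE CONSTANT TERM OF `Res Ẽ − r` VANISHES, ON EVERY FUNDAMENTAL DOMAIN, FOR EVERY HAAR MEASURE — LEVEL-`K′` SECTIONS** (`U(J₂)`, `c² = 1`; the letter (L-CT) of the T1 assembly).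
DATA: a Haar measure `ν'` on `N(𝔸)` and a fundamental domain `𝓕'` of `N(F)` (arbitrary); the reference pair `(ν, 𝓕)` of the LEVEL-`K′` continued constant term (E3′-K′)
`Ẽ(z)_B(g) = φ₁(g)·H(g)^z + ψ(z, g)·H(g)^{1−z}` on `D` (`φ₁` an arbitrary section — no continuity or level hypothesis is needed for this letter; `ψ(z, ·)` the intertwined section); the
continued values `Ẽ` on an open `D ⊇ B(1,ρ)∖{1}` with (E1)(E4)(E2-bd) and left-`G(F)`-invariance; the pole letter `(z−1)ψ(z, g) → r` with ONE constant `r` for every `g`; the pole letter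
`F g =ᶠ (z−1)Ẽ(z)(g)`, analytic at `1`.  CONCLUSION: for every `x`, `u ↦ F(u·x) 1 − r` is integrable on `𝓕'` with `∫_{𝓕'} (F(u·x) 1 − r) dν'(u) = 0` — the shape of ★
`integrableOn_and_setIntegral_residueValue_sub_eq_zero` with `φ₀·r ↦ r`. [cite: MoeglinWaldspurger1995, IV.1.11, II.1.7] [cite: Langlands1976, §7] -/
theorem integrableOn_and_setIntegral_residueValue_sub_eq_zero_level (hc : c * c = 1)
    (ν' : Measure ↥(adelicUnipotent F E c 2)) [ν'.IsHaarMeasure] {𝓕' : Set ↥(adelicUnipotent F E c 2)} (h𝓕' : IsFundamentalDomain ↥(rationalUnipotent F E c 2) 𝓕' ν')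
    (ν : Measure ↥(adelicUnipotent F E c 2)) [ν.IsHaarMeasure] {𝓕 : Set ↥(adelicUnipotent F E c 2)} (h𝓕N : IsFundamentalDomain ↥(rationalUnipotent F E c 2) 𝓕 ν)
    (φ₁ : (quasiSplit F E c 2).Adelic → ℂ) (Ec : ℂ → (quasiSplit F E c 2).Adelic → ℂ) {D : Set ℂ} (hDo : IsOpen D) {ρ : ℝ} (hρ : 0 < ρ) (hρD : ∀ z : ℂ, z ≠ 1 → dist z 1 < ρ → z ∈ D)
    (hEd : ∀ g, DifferentiableOn ℂ (fun z => Ec z g) D) (hE4 : ∀ z ∈ D, Continuous (Ec z))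
    (hEbd : ∀ z₀ ∈ D, ∀ K : Set (quasiSplit F E c 2).Adelic, IsCompact K → ∃ V ∈ 𝓝 z₀, ∃ M : ℝ, ∀ z ∈ V, ∀ g ∈ K, ‖Ec z g‖ ≤ M)
    (hEcinv : ∀ z ∈ D, ∀ (γ : (quasiSplit F E c 2).arithmeticSubgroup) (x : (quasiSplit F E c 2).Adelic), Ec z ((γ : (quasiSplit F E c 2).Adelic) * x) = Ec z x)
    (ψ : ℂ → (quasiSplit F E c 2).Adelic → ℂ) {r : ℂ} (hψ : ∀ g : (quasiSplit F E c 2).Adelic, Tendsto (fun z : ℂ => (z - 1) * ψ z g) (𝓝[≠] 1) (𝓝 r))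
    (hE3 : ∀ z ∈ D, ∀ g : (quasiSplit F E c 2).Adelic,
      borelConstantTerm ν 𝓕 (Ec z) g = φ₁ g * (((borelHeight g : ℝ≥0) : ℝ) : ℂ) ^ z + ψ z g * (((borelHeight g : ℝ≥0) : ℝ) : ℂ) ^ (1 - z))
    (Fp : (quasiSplit F E c 2).Adelic → ℂ → ℂ) (hF : ∀ g, AnalyticAt ℂ (Fp g) 1) (hFE : ∀ g, Fp g =ᶠ[𝓝[≠] 1] fun z => (z - 1) * Ec z g)
    (x : (quasiSplit F E c 2).Adelic) :
    IntegrableOn (fun u : ↥(adelicUnipotent F E c 2) => Fp ((u : (quasiSplit F E c 2).Adelic) * x) 1 - r) 𝓕' ν' ∧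
      ∫ u in 𝓕', (Fp ((u : (quasiSplit F E c 2).Adelic) * x) 1 - r) ∂ν' = 0 := by
  -- structure on `G(𝔸)`, `N(𝔸)`, `N(F)` (the ★ boilerplate of `K2E1CuspFormsMeanZeroCMTwo` ∕ ★ p12)
  haveI := t2Space_adeleRing_of_numberField E
  haveI := locallyCompactSpace_adeleRing' E
  haveI := secondCountableTopology_adeleRing E
  letI : MeasurableSpace (AdeleRing (𝓞 E) E) := borel _
  haveI : BorelSpace (AdeleRing (𝓞 E) E) := ⟨rfl⟩
  haveI : T2Space (quasiSplit F E c 2).Adelic := inferInstanceAs (T2Space (adelic F E c 2 ((StdForm.antidiagonal 2).over E)))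
  haveI : SecondCountableTopology (quasiSplit F E c 2).Adelic := inferInstanceAs (SecondCountableTopology (adelic F E c 2 ((StdForm.antidiagonal 2).over E)))
  haveI : LocallyCompactSpace (quasiSplit F E c 2).Adelic := inferInstanceAs (LocallyCompactSpace (adelic F E c 2 ((StdForm.antidiagonal 2).over E)))
  haveI : LocallyCompactSpace ↥(adelicUnipotent F E c 2) := locallyCompactSpace_adelicUnipotent_two (F := F) (E := E) (c := c)
  haveI : SecondCountableTopology ↥(adelicUnipotent F E c 2) := TopologicalSpace.Subtype.secondCountableTopology _
  haveI : MeasurableConstSMul ↥(rationalUnipotent F E c 2) ↥(adelicUnipotent F E c 2) := ⟨fun γ => (continuous_const.mul continuous_id).measurable⟩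
  haveI : SMulInvariantMeasure ↥(rationalUnipotent F E c 2) ↥(adelicUnipotent F E c 2) ν' :=
    ⟨fun γ s _hs => by
      rw [show (fun u : ↥(adelicUnipotent F E c 2) => γ • u) ⁻¹' s = (fun u : ↥(adelicUnipotent F E c 2) => (γ : ↥(adelicUnipotent F E c 2)) * u) ⁻¹' s from rfl, measure_preimage_mul]⟩
  haveI : SMulInvariantMeasure ↥(rationalUnipotent F E c 2) ↥(adelicUnipotent F E c 2) ν :=
    ⟨fun γ s _hs => by
      rw [show (fun u : ↥(adelicUnipotent F E c 2) => γ • u) ⁻¹' s = (fun u : ↥(adelicUnipotent F E c 2) => (γ : ↥(adelicUnipotent F E c 2)) * u) ⁻¹' s from rfl, measure_preimage_mul]⟩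
  haveI : Countable ↥(rationalUnipotent F E c 2) := by
    haveI : Countable (quasiSplit F E c 2).arithmeticSubgroup := countable_arithmeticSubgroup_quasiSplit
    have hinj : Function.Injective (fun γ : ↥(rationalUnipotent F E c 2) => (⟨((γ : ↥(adelicUnipotent F E c 2)) : (quasiSplit F E c 2).Adelic), γ.2⟩ : (quasiSplit F E c 2).arithmeticSubgroup)) := by
      intro a b h
      exact Subtype.ext (Subtype.ext (congrArg (fun z : (quasiSplit F E c 2).arithmeticSubgroup => (z : (quasiSplit F E c 2).Adelic)) h))
    exact hinj.countable
  -- the compact fundamental domain `𝓕₀ = n(𝓕⁻)` of `N(F)∖N(𝔸)` at `N = 2` (★ `UnitaryGroupLineUnipotentTwo`; compact closure, fundamental for every measure)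
  have hij : (((0 : Fin 2) : ℕ)) + 1 = ((1 : Fin 2) : ℕ) := rfl
  have hN : 2 = 2 * ((0 : Fin 2) : ℕ) + 2 := rfl
  obtain ⟨𝓕₀, h𝓕₀def⟩ : ∃ 𝓕₀ : Set ↥(adelicUnipotent F E c 2),
      𝓕₀ = (fun b : ↥(traceZeroAdele F E c) => middleRootUnipotent hij hN (Multiplicative.ofAdd b)) '' traceZeroFundamentalDomain F E c := ⟨_, rfl⟩
  have h𝓕₀' : IsFundamentalDomain ↥(rationalUnipotent F E c 2) 𝓕₀ ν' := by rw [h𝓕₀def]; exact isFundamentalDomain_image_traceZeroFundamentalDomain_two hij hN hc ν'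
  have h𝓕₀ν : IsFundamentalDomain ↥(rationalUnipotent F E c 2) 𝓕₀ ν := by rw [h𝓕₀def]; exact isFundamentalDomain_image_traceZeroFundamentalDomain_two hij hN hc ν
  obtain ⟨K₀, hK₀c, hK₀⟩ := exists_isCompact_image_traceZeroFundamentalDomain_subset_two (F := F) (E := E) (c := c) hij hN hc
  rw [← h𝓕₀def] at hK₀
  have h𝓕₀m : MeasurableSet 𝓕₀ := by rw [h𝓕₀def]; exact measurableSet_image_traceZeroFundamentalDomain_two hij hN
  have h𝓕₀top : ν' 𝓕₀ < ∞ := (measure_mono hK₀).trans_lt hK₀c.measure_lt_top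
  have h𝓕₀0 : ν' 𝓕₀ ≠ 0 := measure_ne_zero_of_isFundamentalDomain_rationalUnipotent ν' h𝓕₀'
  have hreal0 : (ν' 𝓕₀).toReal ≠ 0 := ENNReal.toReal_ne_zero.2 ⟨h𝓕₀0, h𝓕₀top.ne⟩
  haveI : IsFiniteMeasure (ν'.restrict 𝓕₀) := isFiniteMeasure_restrict.2 h𝓕₀top.ne
  have hD1 : ∀ᶠ z in 𝓝[≠] (1 : ℂ), z ∈ D := by
    filter_upwards [inter_mem_nhdsWithin _ (ball_mem_nhds (1 : ℂ) hρ)] with z hz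
    exact hρD z hz.1 (mem_ball.1 hz.2)
  -- the integrand and its `N(F)`-invariance
  have hRc : Continuous fun g : (quasiSplit F E c 2).Adelic => Fp g 1 := continuous_residueValue Ec hDo hρ hρD hEd hE4 hEbd Fp hF hFE
  have hIc : Continuous fun u : ↥(adelicUnipotent F E c 2) => Fp ((u : (quasiSplit F E c 2).Adelic) * x) 1 - r :=
    (hRc.comp (continuous_subtype_val.mul continuous_const)).sub continuous_const
  have hIinv : ∀ (γ : ↥(rationalUnipotent F E c 2)) (u : ↥(adelicUnipotent F E c 2)),
      Fp ((((γ • u : ↥(adelicUnipotent F E c 2))) : (quasiSplit F E c 2).Adelic) * x) 1 - r = Fp ((u : (quasiSplit F E c 2).Adelic) * x) 1 - r := fun γ u => by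
    show Fp ((((γ : ↥(adelicUnipotent F E c 2)) : (quasiSplit F E c 2).Adelic) * (u : (quasiSplit F E c 2).Adelic)) * x) 1 - r = _
    rw [mul_assoc]
    congr 1
    exact residueValue_rational_mul Ec hD1 hEcinv Fp hF hFE ⟨_, γ.2⟩ _
  -- (i) integrability on `𝓕₀` (continuous integrand, `𝓕₀ ⊆ K₀` compact, `ν' 𝓕₀ < ∞`)
  obtain ⟨M₀, hM₀⟩ := hK₀c.exists_bound_of_continuousOn hIc.continuousOn
  have hint₀ : IntegrableOn (fun u : ↥(adelicUnipotent F E c 2) => Fp ((u : (quasiSplit F E c 2).Adelic) * x) 1 - r) 𝓕₀ ν' :=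
    Measure.integrableOn_of_bounded h𝓕₀top.ne hIc.aestronglyMeasurable (M := M₀) (by
      filter_upwards [ae_restrict_mem h𝓕₀m] with u hu using hM₀ u (hK₀ hu))
  -- (ii) dominated convergence on `𝓕₀`: `∫_{𝓕₀} F(u x) 1 dν' = lim (z−1) ∫_{𝓕₀} Ẽ(z)(u x) dν'`
  have hKx : IsCompact ((fun u : ↥(adelicUnipotent F E c 2) => (u : (quasiSplit F E c 2).Adelic) * x) '' K₀) := hK₀c.image (continuous_subtype_val.mul continuous_const)
  obtain ⟨M₁, -, hM₁, hM₁F⟩ := exists_forall_norm_sub_mul_le_near_one Ec hDo hρ hρD hEd hEbd Fp hF hFE hKx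
  have hlim₁ : Tendsto (fun z : ℂ => ∫ u in 𝓕₀, (z - 1) * Ec z ((u : (quasiSplit F E c 2).Adelic) * x) ∂ν') (𝓝[≠] 1)
      (𝓝 (∫ u in 𝓕₀, Fp ((u : (quasiSplit F E c 2).Adelic) * x) 1 ∂ν')) := by
    refine tendsto_integral_filter_of_dominated_convergence (fun _ => M₁) ?_ ?_ (integrable_const M₁) (ae_of_all _ fun u => ?_)
    · filter_upwards [hD1] with z hz
      exact (continuous_const.mul ((hE4 z hz).comp (continuous_subtype_val.mul continuous_const))).aestronglyMeasurable
    · have hmem : {z : ℂ | z ≠ 1} ∩ ball (1 : ℂ) (ρ / 2) ∈ 𝓝[≠] (1 : ℂ) := inter_mem_nhdsWithin _ (ball_mem_nhds _ (half_pos hρ))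
      filter_upwards [hmem] with z hz
      filter_upwards [ae_restrict_mem h𝓕₀m] with u hu
      exact hM₁ _ ⟨u, hK₀ hu, rfl⟩ z hz.1 (mem_ball.1 hz.2).le
    · have h1 : Tendsto (Fp ((u : (quasiSplit F E c 2).Adelic) * x)) (𝓝[≠] 1) (𝓝 (Fp ((u : (quasiSplit F E c 2).Adelic) * x) 1)) :=
        tendsto_nhdsWithin_of_tendsto_nhds (hF _).continuousAt.tendsto
      exact h1.congr' (hFE _)
  -- (iii) the same integrals through the LEVEL-`K′` constant term, transported from `(ν, 𝓕)` to `(ν', 𝓕₀)`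
  have hCT : ∀ z ∈ D, borelConstantTerm ν' 𝓕₀ (Ec z) x =
      φ₁ x * (((borelHeight x : ℝ≥0) : ℝ) : ℂ) ^ z + ψ z x * (((borelHeight x : ℝ≥0) : ℝ) : ℂ) ^ (1 - z) := fun z hz => by
    have hsmul : ν' = ((haarScalarFactor ν' ν : ℝ≥0) : ℝ≥0∞) • ν := by
      rw [← ENNReal.smul_def]; exact isMulLeftInvariant_eq_smul ν' ν
    have hpos : ((haarScalarFactor ν' ν : ℝ≥0) : ℝ≥0∞) ≠ 0 := by exact_mod_cast (haarScalarFactor_pos_of_isHaarMeasure ν' ν).ne'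
    rw [hsmul, borelConstantTerm_smul_measure_eq ν 𝓕₀ hpos ENNReal.coe_ne_top, borelConstantTerm_eq_of_isFundamentalDomain ν h𝓕₀ν h𝓕N (hEcinv z hz), hE3 z hz]
  have heq : (fun z : ℂ => ∫ u in 𝓕₀, (z - 1) * Ec z ((u : (quasiSplit F E c 2).Adelic) * x) ∂ν') =ᶠ[𝓝[≠] 1] fun z =>
      (z - 1) * (((ν' 𝓕₀).toReal : ℂ) * (φ₁ x * (((borelHeight x : ℝ≥0) : ℝ) : ℂ) ^ z + ψ z x * (((borelHeight x : ℝ≥0) : ℝ) : ℂ) ^ (1 - z))) := by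
    filter_upwards [hD1] with z hz
    rw [integral_const_mul, ← hCT z hz, borelConstantTerm_def, Complex.real_smul, ← mul_assoc ((ν' 𝓕₀).toReal : ℂ), ← Complex.ofReal_mul, mul_inv_cancel₀ hreal0,
      Complex.ofReal_one, one_mul]
  have hH0 : (((borelHeight x : ℝ≥0) : ℝ) : ℂ) ≠ 0 := by exact_mod_cast (borelHeight_pos x).ne'
  have hlim₂ : Tendsto (fun z : ℂ => (z - 1) * (((ν' 𝓕₀).toReal : ℂ) * (φ₁ x * (((borelHeight x : ℝ≥0) : ℝ) : ℂ) ^ z + ψ z x * (((borelHeight x : ℝ≥0) : ℝ) : ℂ) ^ (1 - z))))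
      (𝓝[≠] 1) (𝓝 (((ν' 𝓕₀).toReal : ℂ) * r)) := by
    have hre : ∀ z : ℂ, (z - 1) * (((ν' 𝓕₀).toReal : ℂ) * (φ₁ x * (((borelHeight x : ℝ≥0) : ℝ) : ℂ) ^ z + ψ z x * (((borelHeight x : ℝ≥0) : ℝ) : ℂ) ^ (1 - z))) =
        ((ν' 𝓕₀).toReal : ℂ) * (φ₁ x * ((z - 1) * (((borelHeight x : ℝ≥0) : ℝ) : ℂ) ^ z) + ((z - 1) * ψ z x) * (((borelHeight x : ℝ≥0) : ℝ) : ℂ) ^ (1 - z)) := fun z => by ring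
    simp_rw [hre]
    refine Tendsto.const_mul _ ?_
    have h1 : Tendsto (fun z : ℂ => φ₁ x * ((z - 1) * (((borelHeight x : ℝ≥0) : ℝ) : ℂ) ^ z)) (𝓝[≠] 1) (𝓝 (φ₁ x * (0 * (((borelHeight x : ℝ≥0) : ℝ) : ℂ) ^ (1 : ℂ)))) := by
      refine Tendsto.const_mul _ (tendsto_nhdsWithin_of_tendsto_nhds (Tendsto.mul ?_ (continuousAt_const_cpow hH0).tendsto))
      have : Tendsto (fun z : ℂ => z - 1) (𝓝 1) (𝓝 (1 - 1)) := tendsto_id.sub tendsto_const_nhds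
      rwa [sub_self] at this
    have h2 : Tendsto (fun z : ℂ => ((z - 1) * ψ z x) * (((borelHeight x : ℝ≥0) : ℝ) : ℂ) ^ (1 - z)) (𝓝[≠] 1) (𝓝 (r * (((borelHeight x : ℝ≥0) : ℝ) : ℂ) ^ ((1 : ℂ) - 1))) :=
      (hψ x).mul (tendsto_nhdsWithin_of_tendsto_nhds ((continuousAt_const_cpow hH0).comp_of_eq (continuousAt_const.sub continuousAt_id) rfl).tendsto)
    have h := h1.add h2
    simp only [zero_mul, mul_zero, zero_add, sub_self, Complex.cpow_zero, mul_one] at h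
    exact h
  have hval : ∫ u in 𝓕₀, Fp ((u : (quasiSplit F E c 2).Adelic) * x) 1 ∂ν' = ((ν' 𝓕₀).toReal : ℂ) * r :=
    tendsto_nhds_unique hlim₁ (hlim₂.congr' heq.symm)
  -- (iv) `∫_{𝓕₀} (F(u x) 1 − r) dν' = 0`
  have hintF : IntegrableOn (fun u : ↥(adelicUnipotent F E c 2) => Fp ((u : (quasiSplit F E c 2).Adelic) * x) 1) 𝓕₀ ν' :=
    Measure.integrableOn_of_bounded h𝓕₀top.ne (hRc.comp (continuous_subtype_val.mul continuous_const)).aestronglyMeasurable (M := M₁) (by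
      filter_upwards [ae_restrict_mem h𝓕₀m] with u hu using hM₁F _ ⟨u, hK₀ hu, rfl⟩)
  have hzero₀ : ∫ u in 𝓕₀, (Fp ((u : (quasiSplit F E c 2).Adelic) * x) 1 - r) ∂ν' = 0 := by
    rw [integral_sub hintF (integrableOn_const h𝓕₀top.ne), hval, setIntegral_const, Complex.real_smul, measureReal_def, sub_self]
  -- (v) transport to `𝓕'`
  refine ⟨(h𝓕₀'.integrableOn_iff h𝓕' hIinv).1 hint₀, ?_⟩
  rw [h𝓕'.setIntegral_eq h𝓕₀' hIinv]
  exact hzero₀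

end ConstantTerm

end Summit.HodgeConjecture.HodgeConjecture.Cruxes.H413.K2E1ContinuedEisensteinResidueConstantTermLevelUTwo

end
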